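import Summits.CriticalPhenomena.PercolationContinuityZ3.Theorems.PercNearOneGluingNoHeavyLowerTailSahiCTCLadderThreeRowThreeFacts
import Summits.CriticalPhenomena.PercolationContinuityZ3.Theorems.PercNearOneGluingNoHeavyLowerTailSahiCTCMantel
import HarnessLib

/-!
# `NoHeavyLowerTail` (crux stmt-CriticalPhenomena-4575), P3 lane: per-family bounds for the row `#dbl = 3` of `(L_3)` without the α-edge

Support file (seat `prim-l12-p3`, gen 26; `--supports stmt-CriticalPhenomena-4575`).  Paper proof `prim-l12-p3/ROW3-PROOF-g26.md` §6 (the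
half `D ∉ 𝒳 ∩ 𝒵`).  The bounds of `…RowThreeSums/…RowThreeDegree` that do not use the α-edge `d_j d_k`: the restriction cube pays 2 for
every point of `T` lying in some C-set (`two_mul_card_le_kapR`), the 1-live cubes with a C-loop (`sum_kapL1_ge_sub`: `Σ_Q κ₁(d,Q) ≥
C(τ,2) − #{Q ⊇ C}`), the summed T-vertex DEGREE with Q-degrees (`sum_kapL2_ge_tdeg`: `Σ κ₂ ≥ (τ−2)(qdeg v + 1)`), the summed DEGREE at a
T-vertex lying in C-sets (`sum_kapL2_ge_edeg`), and MANTEL's forcing of a triangle in every cube of a family whose Q-graph is dense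
(`sum_kapL2_ge_of_dense`: `4(#qset − Δ) > (τ−1)² ⇒ Σ_{y₀} κ₂(d,y₀) ≥ τ(τ+2)`).  Nothing is asserted about the crux.
-/

namespace Summit.CriticalPhenomena.PercolationContinuityZ3.Theorems.SahiCTCForms

open Finset MvPolynomial SahiCTCGenFun SahiCTCWeightedLYM

variable {α : Type*} [DecidableEq α] [Fintype α]

section RowThreeZero
variable {𝒳 𝒵 : Finset (Finset α)}

/-- **The restriction cube pays 2 per extendable point**: if `L ⊆ T` consists of points `y` with `y + (D∖x) ∈ 𝒳 ∩ 𝒵` for some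
`x ∈ D`, then `κ_R ≥ 2·#L`. [this work] -/
theorem two_mul_card_le_kapR (h𝒳 : IsUpperSet (𝒳 : Set (Finset α))) (h𝒵 : IsUpperSet (𝒵 : Set (Finset α)))
    (hX3 : ∀ S ∈ 𝒳, 3 ≤ #S) (hZ3 : ∀ S ∈ 𝒵, 3 ≤ #S) {m : α →₀ ℕ} (hD : #(dbl m) = 3) {L : Finset α} (hL : L ⊆ lev m 1)
    (hext : ∀ y ∈ L, ∃ x ∈ dbl m, insert y ((dbl m).erase x) ∈ 𝒳 ∧ insert y ((dbl m).erase x) ∈ 𝒵) :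
    2 * (#L : ℤ) ≤ kapR 𝒳 𝒵 m := by
  unfold kapR
  have hDT : Disjoint (dbl m) (lev m 1) := disjoint_dbl_lev_one m
  set l := L.toList with hl
  have hlnd : l.Nodup := nodup_toList _
  have hls : ∀ y ∈ l, y ∈ dbl m ∪ lev m 1 := fun y hy => mem_union_right _ (hL (mem_toList.1 hy))
  have hKl : Disjoint (dbl m) l.toFinset := by
    rw [disjoint_left]; intro y hyD hyl
    exact disjoint_left.1 hDT hyD (hL (mem_toList.1 (List.mem_toFinset.1 hyl)))
  have hc : ∀ y ∈ l, ∀ s' : Finset α, dbl m ⊆ s' → (2 : ℤ) ≤ kap 𝒳 𝒵 (insert y ∅) s' := fun y hy s' hs' => by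
    rw [insert_empty_eq]
    obtain ⟨x, hx, hxX, hxZ⟩ := hext y (mem_toList.1 hy)
    -- D ∖ x = {x₁, x₂}: the edge x₁ x₂ of the link at y
    have h2 : #((dbl m).erase x) = 2 := by rw [card_erase_of_mem hx, hD]
    obtain ⟨x₁, x₂, h12, he⟩ := card_eq_two.1 h2
    have hx₁ : x₁ ∈ (dbl m).erase x := by rw [he]; simp
    have hx₂ : x₂ ∈ (dbl m).erase x := by rw [he]; simp
    have hs3 : 3 ≤ #s' := by have := card_le_card hs'; omega
    have h := card_add_one_le_kap_single_of_nbrs h𝒳 h𝒵 hX3 hZ3 (b := y) hs3 (hs' (mem_of_mem_erase hx₁)) (S := {x₂})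
      (fun u hu => by rw [mem_singleton.1 hu]; exact mem_erase.2 ⟨h12.symm, hs' (mem_of_mem_erase hx₂)⟩)
      (fun u hu => by rw [mem_singleton.1 hu, ← he]; exact ⟨hxX, hxZ⟩) (singleton_nonempty _)
    rw [card_singleton] at h; push_cast at h; linarith
  have h1 := sum_le_peelSum_of_core (fun _ => (2 : ℤ)) l (dbl m ∪ lev m 1) subset_union_left hKl hc (𝒳 := 𝒳) (𝒵 := 𝒵) (D := ∅)
  have h2 := kap_peel_le h𝒳 h𝒵 l (dbl m ∪ lev m 1) hlnd hls (disjoint_empty_left _) (D := (∅ : Finset α))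
  have h3 := kap_nonneg h𝒳 h𝒵 ((dbl m ∪ lev m 1) \ l.toFinset) ∅ (disjoint_empty_left _)
  have h4 : (l.map fun _ => (2 : ℤ)).sum = 2 * #L := by
    rw [List.map_const', List.sum_replicate, hl, length_toList]; simp [mul_comm]
  linarith

omit [Fintype α] in
/-- **Loops**: the 1-live cubes `(d,Q)` with `Q ⊉ C` have a C-loop, so `Σ_Q κ₁(d,Q) ≥ C(τ,2) − #{Q ⊆ T pair : C ⊆ Q}` for the
C-set `C` of the pair `D∖d`. [this work] -/
theorem sum_kapL1_ge_sub (h𝒳 : IsUpperSet (𝒳 : Set (Finset α))) (h𝒵 : IsUpperSet (𝒵 : Set (Finset α)))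
    (hX3 : ∀ S ∈ 𝒳, 3 ≤ #S) (hZ3 : ∀ S ∈ 𝒵, 3 ≤ #S) {m : α →₀ ℕ} (hD : #(dbl m) = 3) {d : α} (hd : d ∈ dbl m) :
    ((#(lev m 1)).choose 2 : ℤ) - #(((lev m 1).powersetCard 2).filter fun Q =>
        ((lev m 1).filter fun y => insert y ((dbl m).erase d) ∈ 𝒳 ∧ insert y ((dbl m).erase d) ∈ 𝒵) ⊆ Q) ≤
      ∑ Q ∈ (lev m 1).powersetCard 2, kapL1 𝒳 𝒵 m d Q := by
  set C := (lev m 1).filter fun y => insert y ((dbl m).erase d) ∈ 𝒳 ∧ insert y ((dbl m).erase d) ∈ 𝒵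
  have hper : ∀ Q ∈ (lev m 1).powersetCard 2, (if ¬ C ⊆ Q then (1 : ℤ) else 0) ≤ kapL1 𝒳 𝒵 m d Q := fun Q hQ => by
    split_ifs with h
    · unfold kapL1; exact kap_nonneg h𝒳 h𝒵 _ _ (by
        rw [disjoint_insert_right]
        exact ⟨notMem_erase d _, Disjoint.mono (erase_subset d (dbl m)) (sdiff_subset (s := lev m 1) (t := Q)) (disjoint_dbl_lev_one m)⟩)
    · obtain ⟨y, hyC, hyQ⟩ := not_subset.1 h
      obtain ⟨hyT, hyX, hyZ⟩ := mem_filter.1 hyC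
      exact one_le_kapL1_of_C h𝒳 h𝒵 hX3 hZ3 hD hd (mem_sdiff.2 ⟨hyT, hyQ⟩) hyX hyZ
  refine le_trans (le_of_eq ?_) (sum_le_sum hper)
  rw [sum_boole]
  have h := Finset.card_filter_add_card_filter_not (s := (lev m 1).powersetCard 2) (fun Q => C ⊆ Q)
  rw [card_powersetCard] at h
  have h' : (#(((lev m 1).powersetCard 2).filter fun Q => C ⊆ Q) : ℤ) + #(((lev m 1).powersetCard 2).filter fun Q => ¬ C ⊆ Q) =
      ((#(lev m 1)).choose 2 : ℕ) := by exact_mod_cast h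
  linarith

/-- **Summed T-vertex DEGREE with Q-degrees, no α-edge**: `Σ_{y₀} κ₂(d,y₀) ≥ (τ − 2)(qdeg v + 1)` for every `v ∈ T` (`τ ≥ 2`). [this work] -/
theorem sum_kapL2_ge_tdeg (h𝒳 : IsUpperSet (𝒳 : Set (Finset α))) (h𝒵 : IsUpperSet (𝒵 : Set (Finset α)))
    (hX3 : ∀ S ∈ 𝒳, 3 ≤ #S) (hZ3 : ∀ S ∈ 𝒵, 3 ≤ #S) {m : α →₀ ℕ} (hD : #(dbl m) = 3) (hτ : 2 ≤ #(lev m 1)) {d : α} (hd : d ∈ dbl m)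
    {v : α} (hv : v ∈ lev m 1) (hq1 : 1 ≤ qdeg 𝒳 𝒵 m d v) :
    ((#(lev m 1) : ℤ) - 2) * (qdeg 𝒳 𝒵 m d v + 1) ≤ ∑ y₀ ∈ lev m 1, kapL2 𝒳 𝒵 m d y₀ := by
  set N := (lev m 1).filter fun u => u ≠ v ∧ ({v, u} : Finset α) ∈ qset 𝒳 𝒵 m d with hN
  have hNcard : (#N : ℤ) = qdeg 𝒳 𝒵 m d v := by exact_mod_cast card_qnbrs_eq m d v
  have hNT' : N ⊆ (lev m 1).erase v := fun u hu => mem_erase.2 ⟨(mem_filter.1 hu).2.1, (mem_filter.1 hu).1⟩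
  have h0 : ∀ y₀, (0 : ℤ) ≤ kapL2 𝒳 𝒵 m d y₀ := fun y₀ => by
    unfold kapL2; exact kap_nonneg h𝒳 h𝒵 _ _ (by
      rw [disjoint_singleton_left, mem_union, not_or]; exact ⟨notMem_erase d _, fun h =>
        disjoint_left.1 (disjoint_dbl_lev_one m) hd (mem_of_mem_erase h)⟩)
  -- at y₀ ≠ v: κ₂ ≥ #(N ∖ y₀) (≥ 1 + #(N∖y₀) when nonempty, ≥ 0 otherwise)
  have hper : ∀ y₀ ∈ (lev m 1).erase v, (#(N.erase y₀) : ℤ) ≤ kapL2 𝒳 𝒵 m d y₀ := fun y₀ hy₀ => by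
    have hy₀T := mem_of_mem_erase hy₀
    by_cases hne : (N.erase y₀).Nonempty
    · have h := card_add_one_le_kapL2_of_nbrs h𝒳 h𝒵 hX3 hZ3 hD hd hy₀T hτ (v := v)
        (mem_union_right _ (mem_erase.2 ⟨(ne_of_mem_erase hy₀).symm, hv⟩)) (S := N.erase y₀)
        (fun u hu => by
          obtain ⟨huy₀, huN⟩ := mem_erase.1 hu
          obtain ⟨huT, huv, _⟩ := mem_filter.1 huN
          exact mem_erase.2 ⟨huv, mem_union_right _ (mem_erase.2 ⟨huy₀, huT⟩)⟩)
        (fun u hu => by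
          obtain ⟨_, huN⟩ := mem_erase.1 hu
          obtain ⟨_, _, hQ⟩ := mem_filter.1 huN
          exact (mem_filter.1 hQ).2) hne
      linarith
    · rw [not_nonempty_iff_eq_empty.1 hne, card_empty]; exact_mod_cast h0 y₀
  have hsum := sum_le_sum hper
  rw [sum_card_erase_eq hNT'] at hsum
  have hTe : (#((lev m 1).erase v) : ℤ) = #(lev m 1) - 1 := by
    have := card_erase_add_one hv; omega
  have hsplit := sum_erase_add (lev m 1) (fun y₀ => kapL2 𝒳 𝒵 m d y₀) hv
  rw [← hsplit]
  have hv0 := h0 v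
  rw [hTe, hNcard] at hsum
  have hq0 : (0 : ℤ) ≤ qdeg 𝒳 𝒵 m d v := Nat.cast_nonneg _
  have hτ' : (2 : ℤ) ≤ #(lev m 1) := by exact_mod_cast hτ
  -- (τ−2)(q+1) ≤ (τ−2) q + ... : we have Σ_{y₀≠v} ≥ (τ−2)·q ; the "+1" per cube is only available when N∖y₀ ≠ ∅, so we settle for
  -- the weaker bound (τ−2)·q + 0 and add (τ−2) from ... no: use the per-cube bound 1 + #(N∖y₀) when q ≥ 2.
  by_cases hq2 : 2 ≤ qdeg 𝒳 𝒵 m d v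
  · have hper' : ∀ y₀ ∈ (lev m 1).erase v, (1 : ℤ) + #(N.erase y₀) ≤ kapL2 𝒳 𝒵 m d y₀ := fun y₀ hy₀ => by
      have hy₀T := mem_of_mem_erase hy₀
      have hne : (N.erase y₀).Nonempty := card_pos.1 (by
        have : 2 ≤ #N := by exact_mod_cast (show (2 : ℤ) ≤ #N from by rw [hNcard]; exact_mod_cast hq2)
        by_cases h : y₀ ∈ N
        · rw [card_erase_of_mem h]; omega
        · rw [erase_eq_of_notMem h]; omega)
      have h := card_add_one_le_kapL2_of_nbrs h𝒳 h𝒵 hX3 hZ3 hD hd hy₀T hτ (v := v)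
        (mem_union_right _ (mem_erase.2 ⟨(ne_of_mem_erase hy₀).symm, hv⟩)) (S := N.erase y₀)
        (fun u hu => by
          obtain ⟨huy₀, huN⟩ := mem_erase.1 hu
          obtain ⟨huT, huv, _⟩ := mem_filter.1 huN
          exact mem_erase.2 ⟨huv, mem_union_right _ (mem_erase.2 ⟨huy₀, huT⟩)⟩)
        (fun u hu => by
          obtain ⟨_, huN⟩ := mem_erase.1 hu
          obtain ⟨_, _, hQ⟩ := mem_filter.1 huN
          exact (mem_filter.1 hQ).2) hne
      linarith
    have hsum' := sum_le_sum hper'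
    rw [sum_add_distrib, sum_const, nsmul_eq_mul, mul_one, sum_card_erase_eq hNT', hTe, hNcard] at hsum'
    nlinarith [hsum', hv0, hq0]
  · -- qdeg v = 1: N = {w}; every cube y₀ ∉ {v, w} sees the neighbour w of v
    have hq : qdeg 𝒳 𝒵 m d v = 1 := by omega
    have hN1 : #N = 1 := by have := hNcard; rw [hq] at this; exact_mod_cast this
    obtain ⟨w, hNw⟩ := card_eq_one.1 hN1
    have hwN : w ∈ N := by rw [hNw]; exact mem_singleton_self w
    obtain ⟨hwT, hwv, hwQ⟩ := mem_filter.1 hwN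
    have hper1 : ∀ y₀ ∈ ((lev m 1).erase v).erase w, (2 : ℤ) ≤ kapL2 𝒳 𝒵 m d y₀ := fun y₀ hy₀ => by
      have hy₀w : y₀ ≠ w := ne_of_mem_erase hy₀
      have hy₀v : y₀ ≠ v := ne_of_mem_erase (mem_of_mem_erase hy₀)
      have hy₀T : y₀ ∈ lev m 1 := mem_of_mem_erase (mem_of_mem_erase hy₀)
      have h := card_add_one_le_kapL2_of_nbrs h𝒳 h𝒵 hX3 hZ3 hD hd hy₀T hτ (v := v)
        (mem_union_right _ (mem_erase.2 ⟨hy₀v.symm, hv⟩)) (S := {w})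
        (fun u hu => by rw [mem_singleton.1 hu]; exact mem_erase.2 ⟨hwv, mem_union_right _ (mem_erase.2 ⟨hy₀w.symm, hwT⟩)⟩)
        (fun u hu => by rw [mem_singleton.1 hu]; exact (mem_filter.1 hwQ).2) (singleton_nonempty _)
      rw [card_singleton] at h; push_cast at h; linarith
    have hsub : ((lev m 1).erase v).erase w ⊆ lev m 1 := (erase_subset _ _).trans (erase_subset _ _)
    have h1 := sum_le_sum hper1
    have h2 := sum_le_sum_of_subset_of_nonneg hsub (fun y₀ _ _ => h0 y₀) (f := fun y₀ => kapL2 𝒳 𝒵 m d y₀)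
    rw [sum_const, nsmul_eq_mul] at h1
    have hcard : (#(((lev m 1).erase v).erase w) : ℤ) = #(lev m 1) - 2 := by
      have := card_erase_add_one (mem_erase.2 ⟨hwv, hwT⟩); have := card_erase_add_one hv; omega
    rw [hcard] at h1
    rw [hsplit, hq]; push_cast; linarith

/-- **MANTEL in the cubes**: if the Q-graph at `d` is dense, `(τ−1)² < 4·(#qset − Δ)` for a bound `Δ` on its degrees, then every cube
`(d,y₀)` keeps more than `(τ−1)²/4` Q-edges avoiding `y₀`, hence a triangle, so `Σ_{y₀} κ₂(d,y₀) ≥ τ(τ+2)`. [this work] -/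
theorem sum_kapL2_ge_of_dense (h𝒳 : IsUpperSet (𝒳 : Set (Finset α))) (h𝒵 : IsUpperSet (𝒵 : Set (Finset α)))
    (hX3 : ∀ S ∈ 𝒳, 3 ≤ #S) (hZ3 : ∀ S ∈ 𝒵, 3 ≤ #S) {m : α →₀ ℕ} (hD : #(dbl m) = 3) {d : α} (hd : d ∈ dbl m) {Δ : ℕ}
    (hΔ : ∀ v ∈ lev m 1, qdeg 𝒳 𝒵 m d v ≤ Δ) (hdense : (#(lev m 1) - 1) ^ 2 < 4 * (#(qset 𝒳 𝒵 m d) - Δ)) :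
    (#(lev m 1) : ℤ) * (#(lev m 1) + 2) ≤ ∑ y₀ ∈ lev m 1, kapL2 𝒳 𝒵 m d y₀ := by
  have hper : ∀ y₀ ∈ lev m 1, (#(lev m 1) : ℤ) + 2 ≤ kapL2 𝒳 𝒵 m d y₀ := fun y₀ hy₀ => by
    -- the Q-edges avoiding y₀
    set E := (qset 𝒳 𝒵 m d).filter fun Q => y₀ ∉ Q with hE
    have hEsub : ∀ e ∈ E, e ⊆ (lev m 1).erase y₀ ∧ #e = 2 := fun e he => by
      obtain ⟨heQ, hy₀e⟩ := mem_filter.1 he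
      obtain ⟨heT, he2⟩ := mem_powersetCard.1 (mem_filter.1 heQ).1
      exact ⟨fun u hu => mem_erase.2 ⟨fun h => hy₀e (h ▸ hu), heT hu⟩, he2⟩
    have hEcard : #(qset 𝒳 𝒵 m d) ≤ #E + Δ := by
      have h := Finset.card_filter_add_card_filter_not (s := qset 𝒳 𝒵 m d) (fun Q => y₀ ∉ Q)
      rw [← hE] at h
      have h2 : #((qset 𝒳 𝒵 m d).filter fun Q => ¬ (y₀ ∉ Q)) ≤ Δ := by
        refine le_trans (le_of_eq ?_) (hΔ y₀ hy₀)
        unfold qdeg; congr 1; ext Q; simp only [mem_filter, not_not]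
      omega
    have hbig : #((lev m 1).erase y₀) ^ 2 < 4 * #E := by
      rw [card_erase_of_mem hy₀]; omega
    obtain ⟨x, y, z, hxy, hyz, hxz, hxyE, hyzE, hxzE⟩ := exists_triangle_of_sq_lt hEsub hbig
    have hmem : ∀ {u w : α}, ({u, w} : Finset α) ∈ E → u ∈ (dbl m).erase d ∪ (lev m 1).erase y₀ ∧
        (insert d {u, w} ∈ 𝒳 ∧ insert d {u, w} ∈ 𝒵) := fun {u w} h => by
      obtain ⟨hsub, _⟩ := hEsub _ h
      exact ⟨mem_union_right _ (hsub (mem_insert_self _ _)), (mem_filter.1 (mem_filter.1 h).1).2⟩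
    have h := card_add_one_le_kap_single_of_triangle h𝒳 h𝒵 hX3 hZ3 (b := d) (s := (dbl m).erase d ∪ (lev m 1).erase y₀)
      (hmem hxyE).1 (hmem hyzE).1 ((hmem hxzE).1 |> fun _ => (hmem (show ({z, x} : Finset α) ∈ E from by rw [pair_comm]; exact hxzE)).1)
      (hmem hxyE).2 (hmem hyzE).2 (hmem hxzE).2 hxy hyz hxz
    unfold kapL2; rw [card_cubeL2 hD hd hy₀] at h; push_cast at h; linarith
  have := sum_le_sum hper
  rw [sum_const, nsmul_eq_mul] at this; linarith

end RowThreeZero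

end Summit.CriticalPhenomena.PercolationContinuityZ3.Theorems.SahiCTCForms
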